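import Summits.ResolutionOfSingularities.ResolutionOfSingularities.Theorems.PurelyInseparableDim4ResConeGoodInvariant
import Summits.ResolutionOfSingularities.ResolutionOfSingularities.Theorems.PurelyInseparableDim4ResConeSatellitePair
import HarnessLib
import HarnessLib.Audit.Tags

/-!
# Purely inseparable four-folds — THE GOOD-OR-PERMANENT DICHOTOMY OF A BINARY-CONE TAIL, EVERY PRIME `p`, EVERY SHADE: eventually GOOD,
# or some boundary letter is KEPT AT EVERY STEP from some time on (K2(p) lane, SLICE C, rung-0 structure of the `(p, d)` tails; sharpens
# `good_trichotomy`; file-holder res-dim4-p-5 g5)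

[OURS · counted 0 · cell `res-dim4-pi` · K2(p) lane, slice C (general-`p` programme; conjecture posted as DATUM 3, bus 2026-08-29 09:17Z,
now a theorem) · seat p-5 g5.]  Nothing here proves K2(p) for any `p`, `NoIsolatedTrap p p` or resolution of singularities in dimension
≥ 4 / characteristic `p` — NOT proved; a STRUCTURE theorem: slice C(p, d) of OUR frame has exactly two residues, the two-letter game and the
permanent-letter class.  AI kernel work, weaker than expert review.

THE ARGUMENT (no weights beyond «boundary letters weigh ≥ 1»).  Along the tail keep a set `J` of boundary letters about which NOTHING is
known and declare the other non-newborn boundary letters LEAVES: each leaf `y` satisfies TT(newborn, y).  This «star» shape is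
SELF-REPRODUCING: a kept leaf forces the old newborn to be hit (a TT pair is never kept, `not_kept_both_of_tt`) and becomes a leaf of the new
star (`tt_transport_kept`); a kept old newborn (a satellite step) becomes a leaf (`tt_of_satellite`); kept `J`-letters stay in `J`; so
`J ↦ J ∩ (kept)` — the unknown set only SHRINKS.  If GOOD never holds, every satellite step (FT: infinitely many) must keep, besides the old
newborn, a second letter, which cannot be a leaf: a `J`-letter.  A shrinking sequence of subsets of a 4-set that is non-empty infinitely often
is eventually constant and non-empty — and a letter that stays in `J` is KEPT AT EVERY STEP.
* `good_or_permanentStar (p)` — the full export of the argument below: eventually GOOD, or a non-empty set `P` of ≤ 2 PERMANENT letters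
  with every other non-newborn boundary letter a LEAF of the newborn (TT(newborn, y)) at every late time.
* **`good_or_permanent (p)`** — on a witnessed isolated above-floor `Step0 p` chain with `x^{r₀} ∣ F₀`, constant shade `d` and `e_G ≡ 2` from
  `k₀`: EITHER GOOD (≤ 2 boundary letters, the pair TT) from some time on — then an honest pair-confined partner exists
  (`pair_representation_of_support_le_two`, the TWO-LETTER GAME) — OR some letter `z` has `1 ≤ r_m z`, `z ≠ j m`, `b m z = 0` at every late
  `m` (a PERMANENT boundary letter: the B∞ / heavy-kept-letter class of the Φ-line).  Branch (T) of `good_trichotomy` (p710770) is thus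
  inside branch (B), at every `(p, d)`.
[cite: CossartJannsenSaito2020, Thm. 3.10(4), Thm. 3.14, Thm. 9.3] [cite: HauserPerlega2019PRIMS, §2 (transform D′ of D)]
bears_on: LADDER-RESOLUTION:D157-DOOR2 (res-dim4-pi · K2(p) = `RidgeBudget.NoAboveFloorTrap p p` · slice C(p, d): two residues only).
Supports stmt-ResolutionOfSingularities-16155 (helper).
-/

set_option linter.dupNamespace false -- mandated namespace of this single-conjunct summit

noncomputable section

namespace Summit.ResolutionOfSingularities.ResolutionOfSingularities.Theorems.PIDim4

namespace ResCone

open MvPolynomial Finset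
open Literature.AlgebraicGeometry.Resolution
open Literature.AlgebraicGeometry.Resolution.CentreBlowup
open Literature.AlgebraicGeometry.Resolution.Hauser2010
open Literature.AlgebraicGeometry.Resolution.HauserPerlega2019

variable {K : Type} [Field K] [DecidableEq K] (p : ℕ) [Fact p.Prime] [CharP K p]

/-- A non-decreasing bounded sequence of naturals is eventually constant — private copy of
`…ThreeLettersSubTwo`'s `eventually_const_of_mono_bdd` (p711372), inlined so that this file builds on `…GoodInvariant` alone. [folklore] -/
private theorem evConst_of_mono_bdd (f : ℕ → ℕ) (B : ℕ) (hmono : ∀ n, f n ≤ f (n + 1)) (hbdd : ∀ n, f n ≤ B) :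
    ∃ N, ∀ n, N ≤ n → f n = f N := by
  suffices H : ∀ k (g : ℕ → ℕ), (∀ n, g n ≤ g (n + 1)) → (∀ n, g n ≤ B) → B - g 0 ≤ k → ∃ N, ∀ n, N ≤ n → g n = g N from
    H (B - f 0) f hmono hbdd le_rfl
  intro k
  induction k with
  | zero =>
    intro g hg hgb hk
    refine ⟨0, fun n _ => le_antisymm ?_ ?_⟩
    · have := hgb n; omega
    · have hle : ∀ n, g 0 ≤ g n := fun n => by
        induction n with
        | zero => exact le_rfl
        | succ n ih => exact ih.trans (hg n)
      exact hle n
  | succ k ih =>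
    intro g hg hgb hk
    by_cases hconst : ∀ n, g n = g 0
    · exact ⟨0, fun n _ => hconst n⟩
    · push Not at hconst
      obtain ⟨n₁, hn₁⟩ := hconst
      have hle : ∀ n, g 0 ≤ g n := fun n => by
        induction n with
        | zero => exact le_rfl
        | succ n ih' => exact ih'.trans (hg n)
      have hlt : g 0 < g n₁ := lt_of_le_of_ne (hle n₁) (Ne.symm hn₁)
      obtain ⟨N, hN⟩ := ih (fun n => g (n₁ + n)) (fun n => by rw [show n₁ + (n + 1) = n₁ + n + 1 by ring]; exact hg _)
        (fun n => hgb _) (by have := hgb n₁; simp only [Nat.add_zero]; omega)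
      refine ⟨n₁ + N, fun n hn => ?_⟩
      obtain ⟨m, rfl⟩ := Nat.exists_eq_add_of_le hn
      have h := hN (N + m) (by omega)
      rw [show n₁ + (N + m) = n₁ + N + m by ring] at h
      exact h

/-- **GOOD OR A PERMANENT STAR** (every prime `p`, every shade, `e_G ≡ 2`): on a witnessed isolated above-floor `Step0 p` chain with
`x^{r₀} ∣ F₀`, constant shade `d` and `e_G ≡ 2` from `k₀`, either GOOD holds from some time on, or from some time `M` on there is a
NON-EMPTY set `P` of AT MOST TWO boundary letters that are PERMANENT (weight `≥ 1`, never charted, never translated at any `m ≥ M`) such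
that every OTHER boundary letter of `c (m+1)` besides the newborn `j m` is a LEAF of the newborn: TT(`j m`, `y`) at `c (m+1)`.
(`P.card ≤ 2` is FT: three permanent letters would pin the chart letter for ever.) [OURS]
[cite: CossartJannsenSaito2020, Thm. 3.10(4), Thm. 3.14, Thm. 9.3] -/
theorem good_or_permanentStar {c : ℕ → State K} {j : ℕ → Fin 4} {b : ℕ → Fin 4 → K}
    (hc : ∀ k, IsIsolated p (c k).F ∧ Step0 p (c k) (c (k + 1))) (hw : FreeTail.IsWitnessedChain p c j b)
    (hr0 : ∀ e ∈ (c 0).F.support, (c 0).r ≤ e) (hfloor : ∀ k, ordZero (c k).F ≠ p) {k₀ : ℕ} {d : ℕ∞}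
    (hshade : ∀ k, k₀ ≤ k → (c k).shade = d) (he : ∀ k, k₀ ≤ k → Module.finrank K (resVertex (c k)) = 2) :
    (∃ M, k₀ ≤ M ∧ ∀ m, M ≤ m → ((∃ x y : Fin 4, ∀ i, i ≠ x → i ≠ y → (c m).r i = 0) ∧
        (∀ x y : Fin 4, x ≠ y → 1 ≤ (c m).r x → 1 ≤ (c m).r y →
          ∀ v ∈ resVertex (c m), v x = 0 → v y = 0 → v = 0))) ∨
    (∃ M, k₀ ≤ M ∧ ∃ P : Finset (Fin 4), P.Nonempty ∧ P.card ≤ 2 ∧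
      (∀ z ∈ P, ∀ m, M ≤ m → 1 ≤ (c m).r z ∧ z ≠ j m ∧ b m z = 0) ∧
      (∀ m, M ≤ m → ∀ y, y ∉ P → y ≠ j m → 1 ≤ (c (m + 1)).r y →
        ∀ v ∈ resVertex (c (m + 1)), v (j m) = 0 → v y = 0 → v = 0)) := by
  classical
  by_cases hG : ∃ M, k₀ ≤ M ∧ ∀ m, M ≤ m → ((∃ x y : Fin 4, ∀ i, i ≠ x → i ≠ y → (c m).r i = 0) ∧
        (∀ x y : Fin 4, x ≠ y → 1 ≤ (c m).r x → 1 ≤ (c m).r y →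
          ∀ v ∈ resVertex (c m), v x = 0 → v y = 0 → v = 0))
  · exact Or.inl hG
  right
  have hlaw := fun m i (hi : i ≠ j m) => succ_r_apply_of_ne' p hc hw hfloor m hi
  -- GOOD never holds after `k₀ + 1` (it would propagate by `good_succ`)
  have hbad : ∀ m, k₀ + 1 ≤ m → ¬ ((∃ x y : Fin 4, ∀ i, i ≠ x → i ≠ y → (c m).r i = 0) ∧
        (∀ x y : Fin 4, x ≠ y → 1 ≤ (c m).r x → 1 ≤ (c m).r y →
          ∀ v ∈ resVertex (c m), v x = 0 → v y = 0 → v = 0)) := by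
    intro m hm hgood
    apply hG
    refine ⟨m, by omega, fun m' hm' => ?_⟩
    obtain ⟨n, rfl⟩ := Nat.exists_eq_add_of_le hm'
    clear hm'
    induction n with
    | zero => simpa using hgood
    | succ n ih =>
      obtain ⟨m₀, rfl⟩ : ∃ m₀, m = m₀ + 1 := ⟨m - 1, by omega⟩
      have h := good_succ p hc hw hr0 hfloor hshade he (m := m₀ + n) (by omega)
        (by rw [show m₀ + n + 1 = m₀ + 1 + n by ring]; exact ih.2)
      rw [show m₀ + 1 + (n + 1) = m₀ + n + 2 by ring]
      exact h
  -- kept letters keep their weight; hit letters vanish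
  have hkeep : ∀ m i, i ≠ j m → b m i = 0 → (c (m + 1)).r i = (c m).r i := fun m i hi hb => by
    rw [hlaw m i hi, if_pos hb]
  have hhit : ∀ m i, i ≠ j m → 1 ≤ (c (m + 1)).r i → b m i = 0 ∧ 1 ≤ (c m).r i := by
    intro m i hi h1
    rw [hlaw m i hi] at h1
    by_cases hb : b m i = 0
    · rw [if_pos hb] at h1; exact ⟨hb, h1⟩
    · rw [if_neg hb] at h1; exact absurd h1 (by omega)
  -- the UNKNOWN SET `J n` at time `k₀ + n + 1` (newborn `j (k₀ + n)`): shrinks by the kept letters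
  set J : ℕ → Finset (Fin 4) := fun n => Nat.rec
      ((Finset.univ : Finset (Fin 4)).filter fun i => i ≠ j k₀ ∧ 1 ≤ (c (k₀ + 1)).r i)
      (fun n Jn => Jn.filter fun i => i ≠ j (k₀ + n + 1) ∧ b (k₀ + n + 1) i = 0) n with hJ
  have hJ0 : J 0 = (Finset.univ : Finset (Fin 4)).filter fun i => i ≠ j k₀ ∧ 1 ≤ (c (k₀ + 1)).r i := rfl
  have hJs : ∀ n, J (n + 1) = (J n).filter fun i => i ≠ j (k₀ + n + 1) ∧ b (k₀ + n + 1) i = 0 := fun n => rfl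
  have hJsub : ∀ n, J (n + 1) ⊆ J n := fun n => by rw [hJs n]; exact Finset.filter_subset _ _
  -- THE STAR INVARIANT at time `k₀ + n + 1`: `J n` ⊆ boundary ∖ newborn, and every other non-newborn boundary letter is a LEAF
  have hInv : ∀ n, (∀ i ∈ J n, 1 ≤ (c (k₀ + n + 1)).r i ∧ i ≠ j (k₀ + n)) ∧
      (∀ y, 1 ≤ (c (k₀ + n + 1)).r y → y ≠ j (k₀ + n) → y ∉ J n →
        ∀ v ∈ resVertex (c (k₀ + n + 1)), v (j (k₀ + n)) = 0 → v y = 0 → v = 0) := by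
    intro n
    induction n with
    | zero =>
      refine ⟨fun i hi => ?_, fun y hy hyj hyJ => ?_⟩
      · rw [hJ0, Finset.mem_filter] at hi
        simpa using ⟨hi.2.2, hi.2.1⟩
      · exfalso; apply hyJ
        rw [hJ0, Finset.mem_filter]
        exact ⟨Finset.mem_univ _, by simpa using hyj, by simpa using hy⟩
    | succ n ih =>
      obtain ⟨ihJ, ihL⟩ := ih
      have hkn : k₀ ≤ k₀ + n + 1 := by omega
      refine ⟨fun i hi => ?_, fun y hy hyj hyJ => ?_⟩
      · rw [hJs n, Finset.mem_filter] at hi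
        obtain ⟨hiJ, hij, hbi⟩ := hi
        rw [show k₀ + (n + 1) + 1 = k₀ + n + 1 + 1 by ring, show k₀ + (n + 1) = k₀ + n + 1 by ring,
          hkeep (k₀ + n + 1) i hij hbi]
        exact ⟨(ihJ i hiJ).1, hij⟩
      · -- `y` is a boundary letter of `k₀ + n + 2` other than the newborn, not in `J (n+1)`: it was KEPT at step `k₀ + n + 1`
        rw [show k₀ + (n + 1) + 1 = k₀ + n + 1 + 1 by ring] at hy ⊢
        rw [show k₀ + (n + 1) = k₀ + n + 1 by ring] at hyj ⊢
        obtain ⟨hby, hy1⟩ := hhit (k₀ + n + 1) y hyj hy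
        by_cases hyc : y = j (k₀ + n)
        · -- the old newborn kept: a satellite step, TT reborn
          subst hyc
          intro v hv h1 h2
          exact tt_of_satellite p hc hw hr0 hfloor hshade he (show k₀ ≤ k₀ + n by omega) ⟨Ne.symm hyj, hby⟩ v hv h2 h1
        · -- `y` was a leaf (it is not in `J n`, else it would be in `J (n+1)`): its partner, the old newborn, was hit
          have hyJn : y ∉ J n := fun h => hyJ (by rw [hJs n, Finset.mem_filter]; exact ⟨h, hyj, hby⟩)
          have hTT := ihL y hy1 hyc hyJn
          have hchit : j (k₀ + n) = j (k₀ + n + 1) ∨ b (k₀ + n + 1) (j (k₀ + n)) ≠ 0 := by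
            by_contra hno; push Not at hno
            exact not_kept_both_of_tt p hc hw hr0 hfloor hshade hkn hTT hno.1 hno.2 hyj hby
          exact tt_transport_kept p hc hw hr0 hfloor hshade he hkn (Ne.symm hyc) hTT hyj hby hchit
  -- after every SATELLITE step the unknown set is non-empty (else GOOD)
  have hJne : ∀ n, FreeTail.IsSatellite j b (k₀ + n) → (J (n + 1)).Nonempty := by
    intro n hsat
    rw [Finset.nonempty_iff_ne_empty]
    intro hempty
    obtain ⟨-, ihL⟩ := hInv n
    have hkn : k₀ ≤ k₀ + n + 1 := by omega
    -- every boundary letter of `k₀ + n + 2` is the newborn `j (k₀+n+1)` or the old newborn `j (k₀+n)`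
    have hsupp : ∀ i, i ≠ j (k₀ + n + 1) → i ≠ j (k₀ + n) → (c (k₀ + n + 2)).r i = 0 := by
      intro i hi hic
      by_contra hne
      have hi1 : 1 ≤ (c (k₀ + n + 1 + 1)).r i := by rw [show k₀ + n + 1 + 1 = k₀ + n + 2 by ring]; omega
      obtain ⟨hbi, hir⟩ := hhit (k₀ + n + 1) i hi hi1
      by_cases hiJ : i ∈ J n
      · have : i ∈ J (n + 1) := by rw [hJs n, Finset.mem_filter]; exact ⟨hiJ, hi, hbi⟩
        rw [hempty] at this; exact Finset.notMem_empty _ this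
      · exact not_kept_both_of_tt p hc hw hr0 hfloor hshade hkn (ihL i hir hic hiJ) hsat.1.symm hsat.2 hi hbi
    refine hbad (k₀ + n + 2) (by omega) ⟨⟨j (k₀ + n + 1), j (k₀ + n), hsupp⟩, fun x y hxy hx hy => ?_⟩
    have hTT := tt_of_satellite p hc hw hr0 hfloor hshade he (show k₀ ≤ k₀ + n by omega) hsat
    have hmem : ∀ u, 1 ≤ (c (k₀ + n + 2)).r u → u = j (k₀ + n + 1) ∨ u = j (k₀ + n) := by
      intro u hu; by_contra hno; push Not at hno; have := hsupp u hno.1 hno.2; omega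
    intro v hv hvx hvy
    rcases hmem x hx with rfl | rfl <;> rcases hmem y hy with h | h
    · exact absurd h.symm hxy
    · subst h; exact hTT v hv hvy hvx
    · subst h; exact hTT v hv hvx hvy
    · exact absurd h.symm hxy
  -- the unknown set is eventually constant
  obtain ⟨N, hN⟩ := evConst_of_mono_bdd (fun n => 4 - (J n).card) 4
    (fun n => by have := Finset.card_le_card (hJsub n); omega) (fun n => by omega)
  have hcard : ∀ n, N ≤ n → (J n).card = (J N).card := by
    intro n hn
    have h := hN n hn
    have h4 : ∀ m, (J m).card ≤ 4 := fun m => (Finset.card_le_univ _).trans (by simp)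
    have := h4 n; have := h4 N
    omega
  have hJeq : ∀ n, N ≤ n → J n = J N := by
    intro n hn
    obtain ⟨k, rfl⟩ := Nat.exists_eq_add_of_le hn
    induction k with
    | zero => rfl
    | succ k ih =>
      have hsub : J (N + (k + 1)) ⊆ J (N + k) := by rw [show N + (k + 1) = N + k + 1 by ring]; exact hJsub _
      exact (Finset.eq_of_subset_of_card_le hsub (by rw [hcard (N + k) (by omega), hcard (N + (k + 1)) (by omega)])).trans (ih (by omega))
  -- FT: a satellite step beyond `k₀ + N` makes `J` non-empty there, hence `J N` is non-empty
  obtain ⟨k, hk, hsat⟩ := exists_satellite_ge p hc hw (k₀ + N)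
  obtain ⟨n, rfl⟩ : ∃ n, k = k₀ + n := ⟨k - k₀, by omega⟩
  obtain ⟨z, hz⟩ := hJne n hsat
  rw [hJeq (n + 1) (by omega)] at hz
  -- permanence of every `z ∈ J N` from `k₀ + N + 1` on, with weight ≥ 1
  have hperm : ∀ z ∈ J N, ∀ m, k₀ + N + 1 ≤ m → 1 ≤ (c m).r z ∧ z ≠ j m ∧ b m z = 0 := by
    intro z hz m hm
    obtain ⟨t, rfl⟩ := Nat.exists_eq_add_of_le hm
    have hzJ : z ∈ J (N + t + 1) := by rw [hJeq (N + t + 1) (by omega)]; exact hz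
    rw [hJs (N + t), Finset.mem_filter] at hzJ
    obtain ⟨hzJ', hzj, hbz⟩ := hzJ
    have h1 := ((hInv (N + t)).1 z hzJ').1
    rw [show k₀ + (N + t) + 1 = k₀ + N + 1 + t by ring] at h1 hzj hbz
    exact ⟨h1, hzj, hbz⟩
  refine ⟨k₀ + N + 1, by omega, J N, ⟨z, hz⟩, ?_, hperm, fun m hm y hyP hyj hy => ?_⟩
  · -- at most two permanent letters: three would pin the chart letter, contradicting FT
    by_contra h3
    have hcompl : ∀ m, k₀ + N + 1 ≤ m → j m ∈ Finset.univ \ J N := fun m hm =>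
      Finset.mem_sdiff.2 ⟨Finset.mem_univ _, fun hj => (hperm _ hj m hm).2.1 rfl⟩
    have hc1 : (Finset.univ \ J N).card ≤ 1 := by
      rw [Finset.card_sdiff_of_subset (Finset.subset_univ _), Finset.card_univ, Fintype.card_fin]; omega
    obtain ⟨k, hk, hsat'⟩ := exists_satellite_ge p hc hw (k₀ + N + 1)
    exact hsat'.1 (Finset.card_le_one.1 hc1 _ (hcompl (k + 1) (by omega)) _ (hcompl k hk))
  · -- the leaf property at time `m + 1`, newborn `j m`
    obtain ⟨n, rfl⟩ : ∃ n, m = k₀ + n := ⟨m - k₀, by omega⟩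
    exact (hInv n).2 y hy hyj (by rw [hJeq n (by omega)]; exact hyP)

/-- **GOOD OR PERMANENT** (every prime `p`, every shade, `e_G ≡ 2`): on a witnessed isolated above-floor `Step0 p` chain with
`x^{r₀} ∣ F₀`, constant shade `d` and `e_G ≡ 2` from `k₀`, either GOOD holds from some time on, or some boundary letter is kept, untranslated,
with weight `≥ 1`, at every step from some time on. [OURS] [cite: CossartJannsenSaito2020, Thm. 3.10(4), Thm. 3.14, Thm. 9.3] -/
theorem good_or_permanent {c : ℕ → State K} {j : ℕ → Fin 4} {b : ℕ → Fin 4 → K}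
    (hc : ∀ k, IsIsolated p (c k).F ∧ Step0 p (c k) (c (k + 1))) (hw : FreeTail.IsWitnessedChain p c j b)
    (hr0 : ∀ e ∈ (c 0).F.support, (c 0).r ≤ e) (hfloor : ∀ k, ordZero (c k).F ≠ p) {k₀ : ℕ} {d : ℕ∞}
    (hshade : ∀ k, k₀ ≤ k → (c k).shade = d) (he : ∀ k, k₀ ≤ k → Module.finrank K (resVertex (c k)) = 2) :
    (∃ M, k₀ ≤ M ∧ ∀ m, M ≤ m → ((∃ x y : Fin 4, ∀ i, i ≠ x → i ≠ y → (c m).r i = 0) ∧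
        (∀ x y : Fin 4, x ≠ y → 1 ≤ (c m).r x → 1 ≤ (c m).r y →
          ∀ v ∈ resVertex (c m), v x = 0 → v y = 0 → v = 0))) ∨
    (∃ M, k₀ ≤ M ∧ ∃ z : Fin 4, ∀ m, M ≤ m → 1 ≤ (c m).r z ∧ z ≠ j m ∧ b m z = 0) := by
  rcases good_or_permanentStar p hc hw hr0 hfloor hshade he with hG | ⟨M, hM, P, ⟨z, hz⟩, -, hperm, -⟩
  · exact Or.inl hG
  · exact Or.inr ⟨M, hM, z, hperm z hz⟩

end ResCone

end Summit.ResolutionOfSingularities.ResolutionOfSingularities.Theorems.PIDim4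

end
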